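import Summits.NavierStokesRegularity.NavierStokesRegularity.Theses.PlaneEnergyCeiling
import HarnessLib

/-!
# Birth skeleton (BC3) — crux `PlaneEnergyCeiling.PlanarEnergyAPriori` (stmt-NavierStokesRegularity-16855)

Route `route-NavierStokesRegularity-PlaneEnergyCeiling`, crux #2 `PlanarEnergyAPriori` (PLANAR ENERGY CEILING,
per-solution form): along every classical solution `(u, p)` of unforced Navier–Stokes on `ℝ³ × [0,T)` that is
Leray–Hopf from a rapidly decaying datum `u 0`, the planar kinetic energies
`E(t; R, c) = ∫_{R({x₂ = c})} |u(t)|² dA` are bounded uniformly in `t < T`, the direction `R` (a linear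
isometry) and the offset `c`.

This file is the route-level BIRTH CERTIFICATE skeleton of the crux (LENSES-v3 §2 BC3; registrar seat
`planner-skel-stmt-NavierStokesRegularity-16855-0`, 2026-08-17). It types the route header's own foreseen
layer-2 line for this crux — the SLAB ENERGY LAW IN MILD FORM ("PlanarEnergyAPriori ⇐ FluxLedger →
FluxConvergenceBudget → PlanarEnergyAPriori", TWO-LAYER PLAN of the route file) — as four NAMED PIECES, a
sorry-free composition `planarEnergyAPriori_of_stubs`, and the skeleton theorem
`PlanarEnergyAPriori_of : PlanarEnergyAPriori` (the crux BY NAME), with `sorry` occurring ONLY inside the stubs.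

## The mechanism (route header, WHY THIS LINE)

Integrating the local energy EQUALITY `∂ₜ|u|² + 2 div((|u|²/2 + p) u) = νΔ|u|² − 2ν|∇u|²` over the plane
`Π_c = R({x₂ = c})` kills every in-plane divergence and leaves an exact 1-D viscous conservation law in the
offset, `∂ₜE = ν ∂²_c E − 2 ∂_c F − 2ν D`, with the SIGNED sink `D(t;R,c) = ∫_{Π_c} |∇u|² ≥ 0` and the
Bernoulli flux `F(t;R,c) = ∫_{Π_c} (|u|²/2 + p) ⟪u, R e₂⟫ dA` through the plane. Duhamel against the 1-D heat
kernel `G_τ` (for `∂ₜ − ν∂²_c`), dropping the sink and moving `∂_c` onto the kernel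
(`‖∂_c G_τ‖_{L¹(dc)} = (π ν τ)^{-1/2}`), gives the MILD SLAB LAW

  `E(t;R,c) ≤ sup_{c'} E(0;R,c') + 2 ∫₀ᵗ (π ν (t−s))^{-1/2} · osc_{c} F(s;R,·) ds`      (⋆)

(any `c`-independent renormalisation of `F` — in particular the free additive constant `π₀(s)` of the
pressure — drops out of the oscillation `osc_c F = sup_{a,b} |F(a) − F(b)|`). So planar energy can grow ONLY
by flux convergence onto one plane against 1-D diffusion: the crux is reduced to a PARABOLIC
FLUX-CONVERGENCE BUDGET, the route's declared "real crux" one level down.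

## Pieces (four registered stubs; all statements inlined over Literature/Mathlib declarations)

* `stub_initialPlanarCeiling` — RAPID DECAY ⇒ INITIAL PLANAR CEILING (provable now, size M): a datum with
  Fefferman decay (4) (`HasRapidSpatialDecay`: `n = 0, K = 2` gives `|u₀(x)| ≤ C (1+|x|)^{-2}`) has planar
  energies `≤ M₀` on EVERY plane (`∫_{ℝ²} C²(1+|y|)^{-4} dy < ∞`; `lintegral_mono`, no measurability needed;
  isometries preserve `1 + ‖x‖`).
* `stub_decayPersistence` — SPATIAL DECAY PERSISTS ALONG THE CLASSICAL LERAY–HOPF SOLUTION (known theorem,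
  size L–XL): for every `t < T` there are `C₀` and a pressure constant `π₀(s)` with
  `(1+|x|)³ (|u| + |∇u| + |∇²u|) ≤ C₀` and `(1+|x|)² (|p − π₀(s)| + |∇p|) ≤ C₀` on `[0,t] × ℝ³`. Why true:
  weak–strong uniqueness identifies `u` on `[0,t]` with the Kato mild solution from the Schwartz-class datum
  (which is classical exactly as long as `u` is, so `t < T ≤ T*`), whose velocity decays like `|x|^{-4}`,
  gradients faster, and whose pressure `p = R_iR_j(u_iu_j) + π₀(s)` decays like `|x|^{-3}` (instantaneous
  spreading is the reason the orders are 3 and 2, not "rapid"): Brandolese (arXiv:math/0403136, Math. Ann.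
  329 (2004)), Brandolese–Vigneron (J. Math. Pures Appl. 88 (2007)), Kukavica–Torres (weighted bounds,
  2006), Miyakawa (Funkcial. Ekvac. 45 (2002)); Lemarié-Rieusset 2016 §4, §10 (Oseen kernel bounds).
* `stub_slabLawMild` — THE SLAB ENERGY LAW, MILD FORM (⋆) (provable now from the local energy equality; size L
  in mathematics, XL in Lean: Fubini/dominated convergence on planes under the order-(3,2) decay, the slab
  identity `SlabEnergyIdentity` of the route, and the 1-D heat-kernel representation of a bounded classical
  solution of `∂ₜe − ν e_cc = g`): stated for a classical solution on the closed slab `[0,t]` carrying the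
  decay of `stub_decayPersistence`, for every direction `R` and offset `c`.
* `stub_fluxConvergenceBudget` — THE PARABOLIC FLUX-CONVERGENCE BUDGET (OPEN — the load-bearing stub; the
  route's "FluxConvergenceBudget"): along every classical Leray–Hopf solution from a rapidly decaying datum
  on `[0,T)` there is `B` with `∫₀ᵗ (π ν (t−s))^{-1/2} osc_c F(s;R,·) ds ≤ B` for all `t < T` and all `R`.
  It is finite for each fixed `t < T` (decay); the content is uniformity as `t ↑ T`. It implies the crux
  through (⋆); under a Type-I blow-up with the `|y|^{-1}` scar `F ∼ (T−s)^{-1/2}` and the budget diverges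
  logarithmically — exactly the planar log-divergence the crux must exclude (route NUMBERS) — so it is not
  weaker than the crux in that scenario and not cheaply equivalent to it either (probes below). Attack
  (route): split `F = F_ℓ + (F − F_ℓ)` at the parabolic scale `ℓ = √(ν(t−s))`; the smoothed ledger has the
  a-priori signed bound `|∫F_ℓ dt| ≤ E₀(2 + cνΔt/ℓ²)`, the oscillation is paid by planar dissipation.

Probes (BC3, NOTES.md of the registrar seat): for each stub `S`, `S → PlanarEnergyAPriori` and
`S → NavierStokesRegularity` FAIL under `first | exact? | simpa [S] | (unfold S; simpa) | aesop`.
Disproof used: none relevant (no `Disproof.lean`, no `_false_without_` theorem, no landed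
`Theorems/PlanarEnergyAPriori/Negative/*` for this crux at registration time; `ledger negatives` checked).
References: CaffarelliKohnNirenberg1982; LemarieRieusset2016; arXiv:1108.1165 §9; arXiv:1705.04561;
SereginSverak2009; Brandolese2004 (arXiv:math/0403136); KukavicaTorres2006; Miyakawa2002.
-/

-- Sub = summit for this single-conjunct summit: the duplicate namespace component is deliberate.
set_option linter.dupNamespace false

noncomputable section

namespace Summit.NavierStokesRegularity.NavierStokesRegularity.Cruxes.PlanarEnergyAPriori.Birth

open scoped ENNReal
open MeasureTheory

/-! ## The four registered stubs -/

/-- **Stub 1 `stub_initialPlanarCeiling` — RAPID DECAY ⇒ INITIAL PLANAR CEILING.** A datum with Fefferman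
decay (4) has planar kinetic energy `≤ M₀` through every plane `R({x₂ = c})`, uniformly in the direction `R`
and the offset `c` (`n = 0`, `K = 2` in `HasRapidSpatialDecay`; `∫_{ℝ²}(1+|y|)^{-4}dy < ∞`). Provable now,
size M. [Fefferman2000, (4)] -/
theorem stub_initialPlanarCeiling :
    ∀ (u₀ : EuclideanSpace ℝ (Fin 3) → EuclideanSpace ℝ (Fin 3)), Literature.Analysis.FluidPDE.HasRapidSpatialDecay u₀ → ∃ M₀ : ℝ, 0 ≤ M₀ ∧ ∀ (R : EuclideanSpace ℝ (Fin 3) ≃ₗᵢ[ℝ] EuclideanSpace ℝ (Fin 3)) (c : ℝ), ∫⁻ y : EuclideanSpace ℝ (Fin 2), ‖u₀ (R (WithLp.toLp 2 ![y 0, y 1, c]))‖ₑ ^ 2 ≤ ENNReal.ofReal M₀ := by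
  sorry

/-- **Stub 2 `stub_decayPersistence` — ORDER-(3,2) SPATIAL DECAY PERSISTS along a classical Leray–Hopf
solution from a rapidly decaying datum, uniformly on every compact `[0,t] ⊂ [0,T)`: `(1+|x|)³(|u|+|∇u|+|∇²u|) ≤ C₀`
and, for some pressure constant `π₀(s)`, `(1+|x|)²(|p−π₀(s)|+|∇p|) ≤ C₀`. Known theorem (weak–strong
uniqueness onto the Kato solution + space decay of mild solutions: velocity `|x|⁻⁴`, pressure `|x|⁻³`), size
L–XL. [Brandolese2004 arXiv:math/0403136, KukavicaTorres2006, Miyakawa2002, LemarieRieusset2016] -/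
theorem stub_decayPersistence :
    ∀ (ν T : ℝ), 0 < ν → 0 < T → ∀ (u : ℝ → EuclideanSpace ℝ (Fin 3) → EuclideanSpace ℝ (Fin 3)) (p : ℝ → EuclideanSpace ℝ (Fin 3) → ℝ), Literature.Analysis.FluidPDE.IsClassicalNSSolutionOn (Set.Ico 0 T) ν 0 u p → Literature.Analysis.FluidPDE.IsLerayHopfOn T ν 0 (u 0) u → Literature.Analysis.FluidPDE.HasRapidSpatialDecay (u 0) → ∀ t ∈ Set.Ico 0 T, ∃ (C₀ : ℝ) (π₀ : ℝ → ℝ), ∀ s ∈ Set.Icc 0 t, ∀ x : EuclideanSpace ℝ (Fin 3), (1 + ‖x‖) ^ 3 * ‖u s x‖ ≤ C₀ ∧ (1 + ‖x‖) ^ 3 * ‖fderiv ℝ (u s) x‖ ≤ C₀ ∧ (1 + ‖x‖) ^ 3 * ‖iteratedFDeriv ℝ 2 (u s) x‖ ≤ C₀ ∧ (1 + ‖x‖) ^ 2 * |p s x - π₀ s| ≤ C₀ ∧ (1 + ‖x‖) ^ 2 * ‖gradient (p s) x‖ ≤ C₀ := by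
  sorry

/-- **Stub 3 `stub_slabLawMild` — THE SLAB ENERGY LAW IN MILD FORM (⋆).** For a classical solution on the
closed slab `[0,t]` with order-(3,2) decay, every planar energy at time `t` is bounded by the initial planar
ceiling in the same direction plus twice the parabolic flux-convergence functional
`∫₀ᵗ (πν(t−s))^{-1/2} osc_c F(s;R,·) ds` (`F` = Bernoulli flux `∫_{Π}(|u|²/2+p)⟪u,Re₂⟫`; the sink `2νD ≥ 0` is
dropped; `‖∂_cG_τ‖₁ = (πντ)^{-1/2}`). Provable now from the local energy equality (route support
`SlabEnergyIdentity` + 1-D heat-kernel representation), size L (XL in Lean).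
[CaffarelliKohnNirenberg1982, LemarieRieusset2016, MajdaBertozzi2002] -/
theorem stub_slabLawMild :
    ∀ (ν t : ℝ), 0 < ν → 0 < t → ∀ (u : ℝ → EuclideanSpace ℝ (Fin 3) → EuclideanSpace ℝ (Fin 3)) (p : ℝ → EuclideanSpace ℝ (Fin 3) → ℝ), Literature.Analysis.FluidPDE.IsClassicalNSSolutionOn (Set.Icc 0 t) ν 0 u p → (∃ (C₀ : ℝ) (π₀ : ℝ → ℝ), ∀ s ∈ Set.Icc 0 t, ∀ x : EuclideanSpace ℝ (Fin 3), (1 + ‖x‖) ^ 3 * ‖u s x‖ ≤ C₀ ∧ (1 + ‖x‖) ^ 3 * ‖fderiv ℝ (u s) x‖ ≤ C₀ ∧ (1 + ‖x‖) ^ 3 * ‖iteratedFDeriv ℝ 2 (u s) x‖ ≤ C₀ ∧ (1 + ‖x‖) ^ 2 * |p s x - π₀ s| ≤ C₀ ∧ (1 + ‖x‖) ^ 2 * ‖gradient (p s) x‖ ≤ C₀) → ∀ (R : EuclideanSpace ℝ (Fin 3) ≃ₗᵢ[ℝ] EuclideanSpace ℝ (Fin 3)) (c : ℝ), ∫⁻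 y : EuclideanSpace ℝ (Fin 2), ‖u t (R (WithLp.toLp 2 ![y 0, y 1, c]))‖ₑ ^ 2 ≤ (⨆ c' : ℝ, ∫⁻ y : EuclideanSpace ℝ (Fin 2), ‖u 0 (R (WithLp.toLp 2 ![y 0, y 1, c']))‖ₑ ^ 2) + 2 * (∫⁻ s in Set.Ioo 0 t, ENNReal.ofReal ((Real.sqrt (Real.pi * ν * (t - s)))⁻¹) * (⨆ (a : ℝ) (b : ℝ), ‖(∫ y : EuclideanSpace ℝ (Fin 2), (‖u s (R (WithLp.toLp 2 ![y 0, y 1, a]))‖ ^ 2 / 2 + p s (R (WithLp.toLp 2 ![y 0, y 1, a]))) * inner ℝ (u s (R (WithLp.toLp 2 ![y 0, y 1, a]))) (R (EuclideanSpace.single 2 1))) - (∫ y : EuclideanSpace ℝ (Fin 2), (‖u s (R (WithLp.toLp 2 ![y 0, y 1, b]))‖ ^ 2 / 2 + p s (R (WithLp.toLp 2 ![y 0, y 1, b]))) * inner ℝ (u s (R (WithLp.toLp 2 ![y 0, y 1, b]))) (R (EuclideanSpace.single 2 1)))‖ₑ)) := by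
  sorry

/-- **Stub 4 `stub_fluxConvergenceBudget` — THE PARABOLIC FLUX-CONVERGENCE BUDGET (OPEN; load-bearing).**
Along every classical Leray–Hopf solution from a rapidly decaying datum on `[0,T)`:
`∫₀ᵗ (πν(t−s))^{-1/2} osc_c F(s;R,·) ds ≤ B` uniformly in `t < T` and `R`. Finite for each `t < T`; the content
is the uniformity as `t ↑ T` (a Type-I `|y|⁻¹` scar gives `F ∼ (T−s)^{-1/2}` and a log-divergent budget, matching
the planar log-divergence the crux excludes). Why it might fail: the crux's own — Type-II focusing or an energy
sheet fed by colliding jets faster than viscosity thickens it. [CaffarelliKohnNirenberg1982, arXiv:1108.1165,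
arXiv:1705.04561, SereginSverak2009, Hou2022PotentiallySingularNS] -/
theorem stub_fluxConvergenceBudget :
    ∀ (ν T : ℝ), 0 < ν → 0 < T → ∀ (u : ℝ → EuclideanSpace ℝ (Fin 3) → EuclideanSpace ℝ (Fin 3)) (p : ℝ → EuclideanSpace ℝ (Fin 3) → ℝ), Literature.Analysis.FluidPDE.IsClassicalNSSolutionOn (Set.Ico 0 T) ν 0 u p → Literature.Analysis.FluidPDE.IsLerayHopfOn T ν 0 (u 0) u → Literature.Analysis.FluidPDE.HasRapidSpatialDecay (u 0) → ∃ B : ℝ, 0 ≤ B ∧ ∀ t ∈ Set.Ico 0 T, ∀ (R : EuclideanSpace ℝ (Fin 3) ≃ₗᵢ[ℝ] EuclideanSpace ℝ (Fin 3)), (∫⁻ s in Set.Ioo 0 t, ENNReal.ofReal ((Real.sqrt (Real.pi * ν * (t - s)))⁻¹) * (⨆ (a : ℝ) (b : ℝ), ‖(∫ y : EuclideanSpace ℝ (Fin 2), (‖u s (R (WithLp.toLp 2 ![y 0, y 1, a]))‖ ^ 2 / 2 + p s (R (WithLp.toLp 2 ![y 0, y 1, a]))) * inner ℝ (u s (R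 (WithLp.toLp 2 ![y 0, y 1, a]))) (R (EuclideanSpace.single 2 1))) - (∫ y : EuclideanSpace ℝ (Fin 2), (‖u s (R (WithLp.toLp 2 ![y 0, y 1, b]))‖ ^ 2 / 2 + p s (R (WithLp.toLp 2 ![y 0, y 1, b]))) * inner ℝ (u s (R (WithLp.toLp 2 ![y 0, y 1, b]))) (R (EuclideanSpace.single 2 1)))‖ₑ)) ≤ ENNReal.ofReal B := by
  sorry

/-! ## Sorry-free composition -/

/-- **The crux statement from the four pieces** (the implication content of the skeleton; SORRY-FREE, standard
axioms). Hypotheses: the statements of the four stubs, verbatim. Conclusion: the body of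
`PlaneEnergyCeiling.PlanarEnergyAPriori`, verbatim. Proof: `M := M₀ + 2B`; at `t = 0` the initial ceiling; at
`0 < t < T` restrict the classical solution to `[0,t]` (`IsClassicalNSSolutionOn.mono`, `uniqueDiffOn_Icc`), feed
the persisted decay into the mild slab law, bound `sup_{c'} E(0;R,c') ≤ M₀` and the budget by `B`, and add in
`ℝ≥0∞` (`ofReal M₀ + 2·ofReal B = ofReal (M₀ + 2B)` for `M₀, B ≥ 0`). [folklore] -/
theorem planarEnergyAPriori_of_stubs
    (h₁ : ∀ (u₀ : EuclideanSpace ℝ (Fin 3) → EuclideanSpace ℝ (Fin 3)), Literature.Analysis.FluidPDE.HasRapidSpatialDecay u₀ → ∃ M₀ : ℝ, 0 ≤ M₀ ∧ ∀ (R : EuclideanSpace ℝ (Fin 3) ≃ₗᵢ[ℝ] EuclideanSpace ℝ (Fin 3)) (c : ℝ), ∫⁻ y : EuclideanSpace ℝ (Fin 2), ‖u₀ (R (WithLp.toLp 2 ![y 0, y 1, c]))‖ₑ ^ 2 ≤ ENNReal.ofReal M₀)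
    (h₂ : ∀ (ν T : ℝ), 0 < ν → 0 < T → ∀ (u : ℝ → EuclideanSpace ℝ (Fin 3) → EuclideanSpace ℝ (Fin 3)) (p : ℝ → EuclideanSpace ℝ (Fin 3) → ℝ), Literature.Analysis.FluidPDE.IsClassicalNSSolutionOn (Set.Ico 0 T) ν 0 u p → Literature.Analysis.FluidPDE.IsLerayHopfOn T ν 0 (u 0) u → Literature.Analysis.FluidPDE.HasRapidSpatialDecay (u 0) → ∀ t ∈ Set.Ico 0 T, ∃ (C₀ : ℝ) (π₀ : ℝ → ℝ), ∀ s ∈ Set.Icc 0 t, ∀ x : EuclideanSpace ℝ (Fin 3), (1 + ‖x‖) ^ 3 * ‖u s x‖ ≤ C₀ ∧ (1 + ‖x‖) ^ 3 * ‖fderiv ℝ (u s) x‖ ≤ C₀ ∧ (1 + ‖x‖) ^ 3 * ‖iteratedFDeriv ℝ 2 (u s) x‖ ≤ C₀ ∧ (1 + ‖x‖) ^ 2 * |p s x - π₀ s| ≤ C₀ ∧ (1 + ‖x‖) ^ 2 * ‖gradient (p s) x‖ ≤ C₀)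
    (h₃ : ∀ (ν t : ℝ), 0 < ν → 0 < t → ∀ (u : ℝ → EuclideanSpace ℝ (Fin 3) → EuclideanSpace ℝ (Fin 3)) (p : ℝ → EuclideanSpace ℝ (Fin 3) → ℝ), Literature.Analysis.FluidPDE.IsClassicalNSSolutionOn (Set.Icc 0 t) ν 0 u p → (∃ (C₀ : ℝ) (π₀ : ℝ → ℝ), ∀ s ∈ Set.Icc 0 t, ∀ x : EuclideanSpace ℝ (Fin 3), (1 + ‖x‖) ^ 3 * ‖u s x‖ ≤ C₀ ∧ (1 + ‖x‖) ^ 3 * ‖fderiv ℝ (u s) x‖ ≤ C₀ ∧ (1 + ‖x‖) ^ 3 * ‖iteratedFDeriv ℝ 2 (u s) x‖ ≤ C₀ ∧ (1 + ‖x‖) ^ 2 * |p s x - π₀ s| ≤ C₀ ∧ (1 + ‖x‖) ^ 2 * ‖gradient (p s) x‖ ≤ C₀) → ∀ (R : EuclideanSpace ℝ (Fin 3) ≃ₗᵢ[ℝ] EuclideanSpace ℝ (Fin 3)) (c : ℝ), ∫⁻ y : EuclideanSpace ℝ (Fin 2), ‖u t (R (WithLp.toLp 2 ![y 0, y 1,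 c]))‖ₑ ^ 2 ≤ (⨆ c' : ℝ, ∫⁻ y : EuclideanSpace ℝ (Fin 2), ‖u 0 (R (WithLp.toLp 2 ![y 0, y 1, c']))‖ₑ ^ 2) + 2 * (∫⁻ s in Set.Ioo 0 t, ENNReal.ofReal ((Real.sqrt (Real.pi * ν * (t - s)))⁻¹) * (⨆ (a : ℝ) (b : ℝ), ‖(∫ y : EuclideanSpace ℝ (Fin 2), (‖u s (R (WithLp.toLp 2 ![y 0, y 1, a]))‖ ^ 2 / 2 + p s (R (WithLp.toLp 2 ![y 0, y 1, a]))) * inner ℝ (u s (R (WithLp.toLp 2 ![y 0, y 1, a]))) (R (EuclideanSpace.single 2 1))) - (∫ y : EuclideanSpace ℝ (Fin 2), (‖u s (R (WithLp.toLp 2 ![y 0, y 1, b]))‖ ^ 2 / 2 + p s (R (WithLp.toLp 2 ![y 0, y 1, b]))) * inner ℝ (u s (R (WithLp.toLp 2 ![y 0, y 1, b]))) (R (EuclideanSpace.single 2 1)))‖ₑ)))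
    (h₄ : ∀ (ν T : ℝ), 0 < ν → 0 < T → ∀ (u : ℝ → EuclideanSpace ℝ (Fin 3) → EuclideanSpace ℝ (Fin 3)) (p : ℝ → EuclideanSpace ℝ (Fin 3) → ℝ), Literature.Analysis.FluidPDE.IsClassicalNSSolutionOn (Set.Ico 0 T) ν 0 u p → Literature.Analysis.FluidPDE.IsLerayHopfOn T ν 0 (u 0) u → Literature.Analysis.FluidPDE.HasRapidSpatialDecay (u 0) → ∃ B : ℝ, 0 ≤ B ∧ ∀ t ∈ Set.Ico 0 T, ∀ (R : EuclideanSpace ℝ (Fin 3) ≃ₗᵢ[ℝ] EuclideanSpace ℝ (Fin 3)), (∫⁻ s in Set.Ioo 0 t, ENNReal.ofReal ((Real.sqrt (Real.pi * ν * (t - s)))⁻¹) * (⨆ (a : ℝ) (b : ℝ), ‖(∫ y : EuclideanSpace ℝ (Fin 2), (‖u s (R (WithLp.toLp 2 ![y 0, y 1, a]))‖ ^ 2 / 2 + p s (R (WithLp.toLp 2 ![y 0, y 1, a]))) * inner ℝ (u s (R (WithLp.toLp 2 ![y 0, y 1, a]))) (R (EuclideanSpace.single 2 1))) - (∫ y :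 EuclideanSpace ℝ (Fin 2), (‖u s (R (WithLp.toLp 2 ![y 0, y 1, b]))‖ ^ 2 / 2 + p s (R (WithLp.toLp 2 ![y 0, y 1, b]))) * inner ℝ (u s (R (WithLp.toLp 2 ![y 0, y 1, b]))) (R (EuclideanSpace.single 2 1)))‖ₑ)) ≤ ENNReal.ofReal B) :
    ∀ (ν T : ℝ), 0 < ν → 0 < T → ∀ (u : ℝ → EuclideanSpace ℝ (Fin 3) → EuclideanSpace ℝ (Fin 3)) (p : ℝ → EuclideanSpace ℝ (Fin 3) → ℝ), Literature.Analysis.FluidPDE.IsClassicalNSSolutionOn (Set.Ico 0 T) ν 0 u p → Literature.Analysis.FluidPDE.IsLerayHopfOn T ν 0 (u 0) u → Literature.Analysis.FluidPDE.HasRapidSpatialDecay (u 0) → ∃ M : ℝ, ∀ t ∈ Set.Ico 0 T, ∀ (R : EuclideanSpace ℝ (Fin 3) ≃ₗᵢ[ℝ] EuclideanSpace ℝ (Fin 3)) (c : ℝ), ∫⁻ y : EuclideanSpace ℝ (Fin 2), ‖u t (R (WithLp.toLp 2 ![y 0, y 1, c]))‖ₑ ^ 2 ≤ ENNReal.ofReal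 M := by
  intro ν T hν hT u p hcl hLH hdec
  obtain ⟨M₀, hM₀, hinit⟩ := h₁ (u 0) hdec
  obtain ⟨B, hB, hbud⟩ := h₄ ν T hν hT u p hcl hLH hdec
  refine ⟨M₀ + 2 * B, ?_⟩
  intro t ht R c
  have hsum : ENNReal.ofReal (M₀ + 2 * B) = ENNReal.ofReal M₀ + 2 * ENNReal.ofReal B := by
    rw [ENNReal.ofReal_add hM₀ (by positivity), ENNReal.ofReal_mul (by norm_num : (0 : ℝ) ≤ 2),
      ENNReal.ofReal_ofNat]
  rcases eq_or_lt_of_le ht.1 with h0 | htpos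
  · -- the initial slice: the initial planar ceiling
    subst h0
    exact (hinit R c).trans (ENNReal.ofReal_le_ofReal (by linarith))
  · -- a later slice: mild slab law on [0,t] + persisted decay + the budget
    have hcl' : Literature.Analysis.FluidPDE.IsClassicalNSSolutionOn (Set.Icc 0 t) ν 0 u p :=
      hcl.mono (Set.Icc_subset_Ico_right ht.2) (uniqueDiffOn_Icc htpos)
    have hdecay := h₂ ν T hν hT u p hcl hLH hdec t ht
    have hslab := h₃ ν t hν htpos u p hcl' hdecay R c
    refine hslab.trans ?_
    rw [hsum]
    gcongr
    · exact iSup_le fun c' => hinit R c'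
    · exact hbud t ht R

/-! ## The skeleton theorem -/

/-- **`PlanarEnergyAPriori` — the route declaration BY NAME** (item stmt-NavierStokesRegularity-16855), from the
four registered stubs through the sorry-free composition `planarEnergyAPriori_of_stubs` (definitional unfolding
of the route `def` only). The only `sorry` in its closure is the stubs'. -/
theorem PlanarEnergyAPriori_of : Summit.NavierStokesRegularity.NavierStokesRegularity.Theses.PlaneEnergyCeiling.PlanarEnergyAPriori :=
  planarEnergyAPriori_of_stubs stub_initialPlanarCeiling stub_decayPersistence stub_slabLawMild
    stub_fluxConvergenceBudget

end Summit.NavierStokesRegularity.NavierStokesRegularity.Cruxes.PlanarEnergyAPriori.Birth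

end
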